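import Literature.NumberTheory.EllipticCurves.KubotaLeopoldtIwasawaFunctionProofs
import Literature.NumberTheory.EllipticCurves.BernoulliMeasureCharacterSumsProofs
import Literature.NumberTheory.EllipticCurves.PAdicPowerSeriesCharacterEvaluationProofs
import HarnessLib

/-!
# The Kubota–Leopoldt Iwasawa function at the finite-order characters of `Γ`
# (Lang Ch. 4 §3 Thm. 3.2 in the variable `T = ζ − 1`; Washington Thm. 12.2)

Lang, *Cyclotomic Fields I and II*, Ch. 4 §3 (PDF p. 84): `L_p(1−s, χ) = −(1 − χ(c)⟨c⟩^s)⁻¹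
M_p(χE_{1,c})(s)`, Thm. 3.2 `L_p(1−k, χ) = −(1/k)B_{k,χω^{-k}}`; in Iwasawa's variable (§1 Ex. 2)
this is the element `g = −f/h ∈ Λ` of `KubotaLeopoldtIwasawaFunctionProofs`
(`exists_iwasawaFunction_of_bernoulliMeasure`: `f` the transform of `θE_{1,c}`,
`h = 1 − θ(c)c(1+T)^{e}`, `c = ω(c)γ^{e}`). At a character `ρ` of `Γ` of conductor `p^{m+1}`
(Washington §7.2 "second kind"; `ζ = ρ(γ)`) the same element takes the value
`g(ρ(γ) − 1) = −f(ρ(γ) − 1)/h(ρ(γ) − 1) = −(1 − θρ(c)c)B_{1,θρ}/(1 − θ(c)cρ(γ^e)) = −B_{1,θρ}`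
(`ρ(c) = ρ(ω(c))ρ(γ^{e}) = ρ(γ^e)`, a character of `Γ` being trivial on `μ_{p−1}`), i.e.
`L_p(0, χρ) = −B_{1,χρω⁻¹}` (Washington Thm. 5.11 / Thm. 12.2: the twisted special value of the
Kubota–Leopoldt function; Lang Ch. 2 Thm. 2.3/2.4 with **B 7**: `B_{1,ψ} = ∑_{x mod M} ψ(x)B_1(x/M)`).
For the inverted transform `ǧ` (normalisation `T = γ^{−s} − 1`) the value is `−B_{1,θρ⁻¹}`.

* `exists_iwasawaFunction_of_bernoulliMeasure_character` — `exists_iwasawaFunction_of_bernoulliMeasure`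
  with, in addition, for every `m` and every even `ρ : (ℤ/p^{m+1})ˣ → ℂ_pˣ` of `p`-power order:
  `g(ρ(γ) − 1) = −∑_{b mod Np^{m+1}} ρ(b̄)θ(b)B_1(b.val/(Np^{m+1}))` and
  `ǧ(ρ(γ) − 1) = −∑_{b mod Np^{m+1}} ρ⁻¹(b̄)θ(b)B_1(b.val/(Np^{m+1}))` in `ℂ_p`.

Everything is proved; there are no named facts and no new definitions.

## References

* S. Lang, *Cyclotomic Fields I and II*, GTM 121, Springer 1990, Ch. 4 §1 Ex. 2 (PDF p. 79), §3
  (definition of `L_p`, Thm. 3.2; PDF p. 84); Ch. 2 §2 Thm. 2.4, **B 7** (PDF pp. 35, 38).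
  [LangCyclotomic1990]
* L. C. Washington, *Introduction to Cyclotomic Fields*, GTM 83, Thm. 5.11, §7.2, Thm. 12.2.
* B. Mazur, J. Tate, J. Teitelbaum, Invent. Math. 84 (1986), §I.13. [MazurTateTeitelbaum1986]
-/

noncomputable section

open scoped Classical

open Filter Topology Finset PowerSeries

namespace Literature.NumberTheory.EllipticCurves

open CyclotomicZp PadicOneUnits

variable (p : ℕ) [Fact p.Prime]

/-- `1 − C(a)·(1+T)^{e}` is a unit of `Λ` when `1 − a ∈ ℤ_p^×`. [folklore] -/
private theorem isUnit_one_sub_C_mul_binomialSeries' {a : ℤ_[p]} (ha : IsUnit (1 - a)) (e : ℤ_[p]) :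
    IsUnit (1 - PowerSeries.C a * PowerSeries.binomialSeries ℤ_[p] e) := by
  rw [PowerSeries.isUnit_iff_constantCoeff, map_sub, map_one, map_mul,
    PowerSeries.constantCoeff_C, PowerSeries.binomialSeries_constantCoeff, mul_one]
  exact ha

/-- The value `1 − a γ^{x}` is non-zero when `1 − a ∈ ℤ_p^×` (`γ^x ≡ 1 mod p`). [folklore] -/
private theorem one_sub_mul_cycPow_ne_zero' {a : ℤ_[p]} (ha : IsUnit (1 - a)) (x : ℤ_[p]) :
    (1 : ℚ_[p]) - (a : ℚ_[p]) * ((cycPow p x : ℤ_[p]) : ℚ_[p]) ≠ 0 := by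
  have hZ : IsUnit (1 - a * cycPow p x) := by
    rw [PadicInt.isUnit_iff] at ha ⊢
    have e1 : 1 - a * cycPow p x = (1 - a) + (-(a * (cycPow p x - 1))) := by ring
    have hlt : ‖-(a * (cycPow p x - 1))‖ < 1 := by
      rw [norm_neg, norm_mul]
      calc ‖a‖ * ‖cycPow p x - 1‖ ≤ 1 * ‖cycPow p x - 1‖ := by
            gcongr; exact PadicInt.norm_le_one a
        _ < 1 := by rw [one_mul]; exact norm_oneAddPow_sub_one_lt_one _ x
    rw [e1, PadicInt.norm_add_eq_max_of_ne (by rw [ha]; exact hlt.ne'), ha]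
    exact max_eq_left hlt.le
  intro h0
  have : ((1 - a * cycPow p x : ℤ_[p]) : ℚ_[p]) = 0 := by push_cast; exact h0
  rw [PadicInt.coe_eq_zero] at this
  exact hZ.ne_zero this

/-- A character of `Γ` of `p`-power order which is even has an even inverse of `p`-power order.
[folklore] -/
private theorem even_and_orderOf_inv {n : ℕ} (ρ : DirichletCharacter ℂ_[p] (p ^ n)) (heven : ρ.Even)
    (hord : ∃ j : ℕ, orderOf ρ = p ^ j) : ρ⁻¹.Even ∧ ∃ j : ℕ, orderOf ρ⁻¹ = p ^ j := by
  refine ⟨?_, ?_⟩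
  · change ρ⁻¹ (-1) = 1
    rw [MulChar.inv_apply_eq_inv, show ρ (-1) = 1 from heven, Ring.inverse_one]
  · obtain ⟨j, hj⟩ := hord
    exact ⟨j, by rw [orderOf_inv, hj]⟩

/-- **The Kubota–Leopoldt Iwasawa function and its values at `γ^{±(k−1)} − 1` AND at the character
points `ρ(γ) − 1`** (Lang Ch. 4 §3: `L_p(1−s,χ) = −(1 − χ(c)⟨c⟩^s)⁻¹ M_p(χE_{1,c})(s)`, Thm. 3.2;
at a character `ρ` of `Γ` of conductor `p^{m+1}`: `g(ρ(γ) − 1) = −(1 − θρ(c)c)B_{1,θρ} /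
(1 − θ(c)cρ(γ^{e})) = −B_{1,θρ}` since `c = ω(c)γ^{e}` and `ρ(ω(c)) = 1` — Washington Thm. 12.2,
the special value `L_p(0, χρ) = −B_{1,χρω⁻¹}`). Hypotheses as in
`exists_iwasawaFunction_of_bernoulliMeasure`; conclusion: its two clauses, and for every `m` and
every even Dirichlet character `ρ` modulo `p^{m+1}` of `p`-power order with values in `ℂ_p`,
`g(ρ(γ) − 1) = −∑_{b mod Np^{m+1}} ρ(b̄) θ(b) B_1(b.val/(Np^{m+1}))` and
`ǧ(ρ(γ) − 1) = −∑_{b mod Np^{m+1}} ρ⁻¹(b̄) θ(b) B_1(b.val/(Np^{m+1}))`.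
[cite: LangCyclotomic1990, Ch. 4 §3, definition of L_p and Thm. 3.2 (PDF p. 84); Ch. 2 §2 Thm. 2.4, B 7 (PDF pp. 35, 38)]
[cite: MazurTateTeitelbaum1986, §I.13 (evaluation of Λ-adic transforms at the characters of Γ)] -/
theorem exists_iwasawaFunction_of_bernoulliMeasure_character (hp : p ≠ 2) {N : ℕ} [NeZero N]
    {c : ℕ} (hc : c.Coprime (N * p)) {θ : ℕ → ℤ_[p]} (hθ : ∀ b, θ (b + N) = θ b)
    (hθp : ∀ b, p ∣ b → θ b = 0) (hθc : ∀ x, θ (c * x) = θ c * θ x)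
    (hunit : IsUnit (1 - θ c * c : ℤ_[p]))
    (Θ : ℕ → ℕ → ℤ_[p]) (hΘN : ∀ j b, Θ j (b + N) = Θ j b) (hΘp : ∀ j b, p ∣ b → Θ j b = 0)
    (hΘc : ∀ j x, Θ j (c * x) = Θ j c * Θ j x)
    (hΘω : ∀ (j b : ℕ) (η : rootsOfUnity (torsionOrder p) ℤ_[p]),
      (b : ZMod p) = PadicInt.toZMod ((η : ℤ_[p]ˣ) : ℤ_[p]) →
        Θ j b * ((η : ℤ_[p]ˣ) : ℤ_[p]) ^ j = θ b) :
    ∃ g g' : PowerSeries ℤ_[p], (∀ j : ℕ,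
      HasSum (fun n ↦ ((PowerSeries.coeff n g : ℤ_[p]) : ℚ_[p]) *
          (((cyclotomicGenerator p : ℕ) : ℚ_[p]) ^ j - 1) ^ n)
        (-((((j + 1 : ℕ) : ℚ_[p]))⁻¹ * ((N : ℚ_[p]) ^ j *
          ∑ i ∈ Finset.range N, ((Θ j i : ℤ_[p]) : ℚ_[p]) *
            (((Polynomial.bernoulli (j + 1)).eval ((i : ℚ) / N) : ℚ) : ℚ_[p])))) ∧
      HasSum (fun n ↦ ((PowerSeries.coeff n g' : ℤ_[p]) : ℚ_[p]) *
          ((((cyclotomicGenerator p : ℕ) : ℚ_[p])⁻¹) ^ j - 1) ^ n)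
        (-((((j + 1 : ℕ) : ℚ_[p]))⁻¹ * ((N : ℚ_[p]) ^ j *
          ∑ i ∈ Finset.range N, ((Θ j i : ℤ_[p]) : ℚ_[p]) *
            (((Polynomial.bernoulli (j + 1)).eval ((i : ℚ) / N) : ℚ) : ℚ_[p]))))) ∧
      ∀ (m : ℕ) (ρ : DirichletCharacter ℂ_[p] (p ^ (m + 1))), ρ.Even →
        (∃ j : ℕ, orderOf ρ = p ^ j) →
        HasSum (fun n ↦ ((algebraMap ℚ_[p] ℂ_[p]).comp (algebraMap ℤ_[p] ℚ_[p]))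
            (PowerSeries.coeff n g) * (ρ (cyclotomicGenerator p : ZMod (p ^ (m + 1))) - 1) ^ n)
          (-(∑ b : ZMod (N * p ^ (m + 1)),
            ρ (ZMod.castHom (Dvd.intro_left N rfl) (ZMod (p ^ (m + 1))) b) *
              algebraMap ℚ_[p] ℂ_[p] (((θ b.val : ℤ_[p]) : ℚ_[p]) *
                ((bernoulliDist 1 (N * p ^ (m + 1)) b : ℚ) : ℚ_[p])))) ∧
        HasSum (fun n ↦ ((algebraMap ℚ_[p] ℂ_[p]).comp (algebraMap ℤ_[p] ℚ_[p]))
            (PowerSeries.coeff n g') * (ρ (cyclotomicGenerator p : ZMod (p ^ (m + 1))) - 1) ^ n)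
          (-(∑ b : ZMod (N * p ^ (m + 1)),
            ρ⁻¹ (ZMod.castHom (Dvd.intro_left N rfl) (ZMod (p ^ (m + 1))) b) *
              algebraMap ℚ_[p] ℂ_[p] (((θ b.val : ℤ_[p]) : ℚ_[p]) *
                ((bernoulliDist 1 (N * p ^ (m + 1)) b : ℚ) : ℚ_[p])))) := by
  -- the transforms of `θE_{1,c}` and of its inversion, with the character clause
  obtain ⟨f, f', hf, hf', hval, hchar⟩ := exists_transforms_bernoulliMeasure_character p hp hc hθ hθp
  -- `c = ζ γ^{e}`
  have hcp : ¬ p ∣ c := fun h ↦ by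
    have := Nat.Coprime.coprime_dvd_right (Dvd.intro_left N rfl) hc
    exact (Nat.Prime.coprime_iff_not_dvd Fact.out).mp this.symm h
  have hcunit : IsUnit (c : ℤ_[p]) := by
    rw [PadicInt.isUnit_iff, ← PadicInt.padic_norm_e_of_padicInt, PadicInt.coe_natCast,
      Padic.norm_natCast_eq_one_iff]
    exact (Nat.Prime.coprime_iff_not_dvd Fact.out).mpr hcp
  obtain ⟨ζ, e, hce, hζ⟩ := exists_rootsOfUnity_mul_cycPow p hcunit.unit
  rw [IsUnit.unit_spec] at hce hζ
  rw [map_natCast] at hζ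
  -- the regularising units `h = 1 − θ(c)c (1+T)^{e}`, `h' = 1 − θ(c)c (1+T)^{-e}`
  set a : ℤ_[p] := θ c * c with ha
  have hh := isUnit_one_sub_C_mul_binomialSeries' p hunit e
  have hh' := isUnit_one_sub_C_mul_binomialSeries' p hunit (-e)
  -- integral lifts of `f`, `f'`
  set fZ : PowerSeries ℤ_[p] := PowerSeries.mk fun n ↦ ⟨PowerSeries.coeff n f, hf n⟩ with hfZ
  set fZ' : PowerSeries ℤ_[p] := PowerSeries.mk fun n ↦ ⟨PowerSeries.coeff n f', hf' n⟩ with hfZ'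
  have hcoe : ∀ n, ((PowerSeries.coeff n fZ : ℤ_[p]) : ℚ_[p]) = PowerSeries.coeff n f := fun n ↦ by
    rw [hfZ, PowerSeries.coeff_mk]
  have hcoe' : ∀ n, ((PowerSeries.coeff n fZ' : ℤ_[p]) : ℚ_[p]) = PowerSeries.coeff n f' := fun n ↦ by
    rw [hfZ', PowerSeries.coeff_mk]
  refine ⟨-(fZ * ↑(hh.unit⁻¹)), -(fZ' * ↑(hh'.unit⁻¹)), fun j ↦ ?_, fun m ρ heven hord ↦ ?_⟩
  · -- the values at `γ^{±j} − 1` (as in `exists_iwasawaFunction_of_bernoulliMeasure`)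
    obtain ⟨hvj, hvj'⟩ := hval j (Θ j) (hΘN j) (hΘp j) (hΘc j) (hΘω j)
    set S : ℚ_[p] := (N : ℚ_[p]) ^ j * ∑ i ∈ Finset.range N, ((Θ j i : ℤ_[p]) : ℚ_[p]) *
      (((Polynomial.bernoulli (j + 1)).eval ((i : ℚ) / N) : ℚ) : ℚ_[p]) with hS
    set w : ℚ_[p] := 1 - (a : ℚ_[p]) * ((cycPow p ((j : ℤ_[p]) * e) : ℤ_[p]) : ℚ_[p]) with hw
    have hw0 : w ≠ 0 := one_sub_mul_cycPow_ne_zero' p hunit _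
    have hreg : (1 : ℚ_[p]) - ((Θ j c : ℤ_[p]) : ℚ_[p]) * (c : ℚ_[p]) ^ (j + 1) = w := by
      have hrel := hΘω j c ζ hζ.symm
      have h1 : ((Θ j c : ℤ_[p]) : ℚ_[p]) * (c : ℚ_[p]) ^ (j + 1) =
          (a : ℚ_[p]) * ((cycPow p ((j : ℤ_[p]) * e) : ℤ_[p]) : ℚ_[p]) := by
        rw [ha, ← nsmul_eq_mul, AddChar.map_nsmul_eq_pow]
        have : (c : ℤ_[p]) ^ (j + 1) = c * (((ζ : ℤ_[p]ˣ) : ℤ_[p]) ^ j * cycPow p e ^ j) := by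
          rw [pow_succ', hce, mul_pow, ← hce]
        rw [← PadicInt.coe_natCast, ← PadicInt.coe_pow, this]
        push_cast
        rw [← PadicInt.coe_pow ((ζ : ℤ_[p]ˣ) : ℤ_[p]), ← hrel]
        push_cast
        ring
      rw [hw, h1]
    have hxj : ((cycPow p (j : ℤ_[p]) : ℤ_[p]) : ℚ_[p]) - 1 =
        ((cyclotomicGenerator p : ℕ) : ℚ_[p]) ^ j - 1 := by rw [coe_cycPow_natCast]
    have hxj' : ((cycPow p (-(j : ℤ_[p])) : ℤ_[p]) : ℚ_[p]) - 1 =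
        (((cyclotomicGenerator p : ℕ) : ℚ_[p])⁻¹) ^ j - 1 := by rw [coe_cycPow_neg_natCast]
    have hnorm : ‖((cyclotomicGenerator p : ℕ) : ℚ_[p]) ^ j - 1‖ < 1 :=
      norm_cyclotomicGenerator_pow_sub_one_lt j
    have hnorm' : ‖(((cyclotomicGenerator p : ℕ) : ℚ_[p])⁻¹) ^ j - 1‖ < 1 :=
      norm_cyclotomicGenerator_inv_pow_sub_one_lt j
    have hhval : HasSum (fun n ↦ ((PowerSeries.coeff n (hh.unit : PowerSeries ℤ_[p]) : ℤ_[p]) : ℚ_[p]) *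
        (((cyclotomicGenerator p : ℕ) : ℚ_[p]) ^ j - 1) ^ n) w := by
      have h := hasSum_intCoeff_one_sub_C_mul_binomialSeries p a (j : ℤ_[p]) e
      rw [hxj] at h
      rw [IsUnit.unit_spec]
      exact h
    have hhval' : HasSum (fun n ↦ ((PowerSeries.coeff n (hh'.unit : PowerSeries ℤ_[p]) : ℤ_[p]) : ℚ_[p]) *
        ((((cyclotomicGenerator p : ℕ) : ℚ_[p])⁻¹) ^ j - 1) ^ n) w := by
      have h := hasSum_intCoeff_one_sub_C_mul_binomialSeries p a (-(j : ℤ_[p])) (-e)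
      rw [hxj', neg_mul_neg] at h
      rw [IsUnit.unit_spec]
      exact h
    have hfval : HasSum (fun n ↦ ((PowerSeries.coeff n fZ : ℤ_[p]) : ℚ_[p]) *
        (((cyclotomicGenerator p : ℕ) : ℚ_[p]) ^ j - 1) ^ n) ((((j + 1 : ℕ) : ℚ_[p]))⁻¹ * w * S) := by
      simp_rw [hcoe]; rw [← hreg]; exact hvj
    have hfval' : HasSum (fun n ↦ ((PowerSeries.coeff n fZ' : ℤ_[p]) : ℚ_[p]) *
        ((((cyclotomicGenerator p : ℕ) : ℚ_[p])⁻¹) ^ j - 1) ^ n) ((((j + 1 : ℕ) : ℚ_[p]))⁻¹ * w * S) := by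
      simp_rw [hcoe']; rw [← hreg]; exact hvj'
    have htarget : -((((j + 1 : ℕ) : ℚ_[p]))⁻¹ * w * S * w⁻¹) = -((((j + 1 : ℕ) : ℚ_[p]))⁻¹ * S) := by
      field_simp
    refine ⟨?_, ?_⟩
    · have h := (hasSum_intCoeff_mul_mul_pow hnorm hfval (hasSum_intCoeff_inv_mul_pow hnorm hhval)).neg
      rw [htarget] at h
      refine h.congr_fun fun n ↦ ?_
      simp only [map_neg, PadicInt.coe_neg, neg_mul]
    · have h := (hasSum_intCoeff_mul_mul_pow hnorm' hfval' (hasSum_intCoeff_inv_mul_pow hnorm' hhval')).neg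
      rw [htarget] at h
      refine h.congr_fun fun n ↦ ?_
      simp only [map_neg, PadicInt.coe_neg, neg_mul]
  · -- the values at the character point `z = ρ(γ) − 1`
    obtain ⟨hfc, hfc'⟩ := hchar m ρ heven hord
    obtain ⟨heven', hord'⟩ := even_and_orderOf_inv p ρ heven hord
    set ιZ : ℤ_[p] →+* ℂ_[p] := (algebraMap ℚ_[p] ℂ_[p]).comp (algebraMap ℤ_[p] ℚ_[p]) with hιZ
    set ι : ℚ_[p] →+* ℂ_[p] := algebraMap ℚ_[p] ℂ_[p] with hι
    set z : ℂ_[p] := ρ (cyclotomicGenerator p : ZMod (p ^ (m + 1))) - 1 with hz_def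
    have hz : ‖z‖ < 1 := norm_apply_cyclotomicGenerator_sub_one_lt ρ hord
    -- `ρ(c) = ρ(γ^e)`, `ρ⁻¹(c) = ρ(γ^{-e})`
    have hcbar : (c : ZMod (p ^ (m + 1))) = PadicInt.toZModPow (m + 1) ((ζ : ℤ_[p]ˣ) : ℤ_[p]) *
        PadicInt.toZModPow (m + 1) (cycPow p e) := by
      rw [← map_mul, ← hce, map_natCast]
    have hρc : ρ (c : ZMod (p ^ (m + 1))) = ρ (PadicInt.toZModPow (m + 1) (cycPow p e)) := by
      rw [hcbar, map_mul, apply_toZModPow_rootsOfUnity ρ heven hord ζ, one_mul]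
    have hinvu : PadicInt.toZModPow (m + 1) (cycPow p e) * PadicInt.toZModPow (m + 1) (cycPow p (-e)) =
        1 := by
      rw [← map_mul, ← AddChar.map_add_eq_mul, add_neg_cancel, AddChar.map_zero_eq_one, map_one]
    have hρc' : ρ⁻¹ (c : ZMod (p ^ (m + 1))) = ρ (PadicInt.toZModPow (m + 1) (cycPow p (-e))) := by
      rw [hcbar, map_mul, apply_toZModPow_rootsOfUnity ρ⁻¹ heven' hord' ζ, one_mul, MulChar.inv_apply]
      congr 1
      have hu : IsUnit (PadicInt.toZModPow (m + 1) (cycPow p e)) := IsUnit.of_mul_eq_one _ hinvu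
      rw [← hu.unit_spec, Ring.inverse_unit]
      exact Units.inv_eq_of_mul_eq_one_right (by rw [hu.unit_spec]; exact hinvu)
    have hcU : IsUnit (c : ZMod (p ^ (m + 1))) := by
      have hcop : c.Coprime (p ^ (m + 1)) :=
        Nat.Coprime.pow_right _ ((Nat.Prime.coprime_iff_not_dvd Fact.out).mpr hcp).symm
      rw [← ZMod.coe_unitOfCoprime c hcop]
      exact Units.isUnit _
    -- the sums `S`, `S'` and the common factor `w`
    set S : ℂ_[p] := ∑ b : ZMod (N * p ^ (m + 1)),
      ρ (ZMod.castHom (Dvd.intro_left N rfl) (ZMod (p ^ (m + 1))) b) *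
        ι (((θ b.val : ℤ_[p]) : ℚ_[p]) * ((bernoulliDist 1 (N * p ^ (m + 1)) b : ℚ) : ℚ_[p])) with hS
    set S' : ℂ_[p] := ∑ b : ZMod (N * p ^ (m + 1)),
      ρ⁻¹ (ZMod.castHom (Dvd.intro_left N rfl) (ZMod (p ^ (m + 1))) b) *
        ι (((θ b.val : ℤ_[p]) : ℚ_[p]) * ((bernoulliDist 1 (N * p ^ (m + 1)) b : ℚ) : ℚ_[p])) with hS'
    set w : ℂ_[p] := 1 - ιZ a * ρ (PadicInt.toZModPow (m + 1) (cycPow p e)) with hw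
    set w' : ℂ_[p] := 1 - ιZ a * ρ (PadicInt.toZModPow (m + 1) (cycPow p (-e))) with hw'
    have hw0 : w ≠ 0 := one_sub_mul_ne_zero_of_isUnit_of_norm_sub_one_lt hunit
      (by rw [← hρc]; exact norm_apply_sub_one_lt_of_isUnit ρ hord hcU)
    have hw0' : w' ≠ 0 := one_sub_mul_ne_zero_of_isUnit_of_norm_sub_one_lt hunit
      (by rw [← hρc']; exact norm_apply_sub_one_lt_of_isUnit ρ⁻¹ hord' hcU)
    have hιa : ιZ a = ι ((θ c : ℤ_[p]) : ℚ_[p]) * (c : ℂ_[p]) := by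
      rw [hιZ, RingHom.comp_apply, PadicInt.algebraMap_apply, ha, PadicInt.coe_mul, PadicInt.coe_natCast,
        map_mul, map_natCast]
    -- the values of `f`, `f'` at `z`
    have hfval : HasSum (fun n ↦ ιZ (PowerSeries.coeff n fZ) * z ^ n) (w * S) := by
      have h := hfc
      rw [sum_character_mul_bernoulliMeasure_one p hc hθ hθc (m + 1) ρ] at h
      have e1 : (1 - ι ((θ c : ℤ_[p]) : ℚ_[p]) * ρ (c : ZMod (p ^ (m + 1))) * (c : ℂ_[p])) = w := by
        rw [hw, hιa, hρc]; ring
      rw [e1] at h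
      refine h.congr_fun fun n ↦ ?_
      rw [hιZ, RingHom.comp_apply, PadicInt.algebraMap_apply, hcoe]
    have hfval' : HasSum (fun n ↦ ιZ (PowerSeries.coeff n fZ') * z ^ n) (w' * S') := by
      have h := hfc'
      rw [sum_character_mul_invUnitsDist, sum_character_mul_bernoulliMeasure_one p hc hθ hθc (m + 1) ρ⁻¹]
        at h
      have e1 : (1 - ι ((θ c : ℤ_[p]) : ℚ_[p]) * ρ⁻¹ (c : ZMod (p ^ (m + 1))) * (c : ℂ_[p])) = w' := by
        rw [hw', hιa, hρc']; ring
      rw [e1] at h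
      refine h.congr_fun fun n ↦ ?_
      rw [hιZ, RingHom.comp_apply, PadicInt.algebraMap_apply, hcoe']
    -- the values of the regularising units at `z`
    have hhval : HasSum (fun n ↦ ιZ (PowerSeries.coeff n (hh.unit : PowerSeries ℤ_[p])) * z ^ n) w := by
      rw [IsUnit.unit_spec]
      exact hasSum_cpCoeff_one_sub_C_mul_binomialSeries_character ρ hord a e
    have hhval' : HasSum (fun n ↦ ιZ (PowerSeries.coeff n (hh'.unit : PowerSeries ℤ_[p])) * z ^ n) w' := by
      rw [IsUnit.unit_spec]
      exact hasSum_cpCoeff_one_sub_C_mul_binomialSeries_character ρ hord a (-e)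
    refine ⟨?_, ?_⟩
    · have h := (hasSum_cpCoeff_mul hz hfval (hasSum_cpCoeff_inv hz hhval)).neg
      rw [show -(w * S * w⁻¹) = -S by field_simp] at h
      refine h.congr_fun fun n ↦ ?_
      simp only [map_neg, neg_mul, hιZ, hι]
    · have h := (hasSum_cpCoeff_mul hz hfval' (hasSum_cpCoeff_inv hz hhval')).neg
      rw [show -(w' * S' * w'⁻¹) = -S' by field_simp] at h
      refine h.congr_fun fun n ↦ ?_
      simp only [map_neg, neg_mul, hιZ, hι]

end Literature.NumberTheory.EllipticCurves

end
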